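import Summits.QuantumFields.YangMills.Theorems.UnitScaleTiltProp7PillarsPrint
import Summits.QuantumFields.YangMills.Theorems.UnitScaleTiltProp7PrintLettersSanity
import Summits.QuantumFields.YangMills.Theorems.UnitScaleTiltProp7Orbit16Unsat
import HarnessLib

/-!
# Route `UnitScaleTilt`, crux K1 child «MinimiserStabilityRegPr» (stmt-QuantumFields-19200), registered stub `stub_prop7From14` (skeleton birth_v7
# cc37a178…; leaf V3) — DEFINITIONS FILE: **PRINT'S PRESENTATION `S_print` OF [Balaban1985Variational] SECT. A AT THE T³ CARRIER**, the Sect. A–B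
# letters of `T3SectALandauChart.Resid` PINNED to the `ℤᵈ` letters of record of [Balaban1985RegularSpaces] (1.19) ∕ (1.29) ∕ (1.38) read on the
# periodic pullbacks BASED AT THE `k`-CENTRE `x₀ = embIter (K−n) 0` (OWNER RULING g23-№3 (α); CARD-19200-V3-g8 §1(e))

Cell `ym3-torus` ∕ width seat `ym-ust-19200-w1` (gen 0; D-0149 ∕ director l-ym3-bs; HUMAN RULING D-0037, YM ladder rung R3 — continuum SU(2) YM₃ on the
3-torus is a RUNG, not the Clay problem).  WHY.  The v8 re-cut of the leaf V3 (OWNER ym3-torus-plan g23, 2026-08-27 20:03Z + RULING g23-№3) splits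
`stub_prop7From14` into P-V3-A′ := `B11.Prop2Printed … (famLG3 L S_print)` and P-V3-CDE := `Prop5Printed ∧ Prop6Printed … (famLG3 L S_print)` + leaves,
glued BY NAME by `Prop7PillarsPrint.prop7From14At_of_pillars_print` (p572062) — FOR A PRESENTATION `S_print : T3SectALandauChart.ResidFam L` whose `IsAxial`
IS the based (1.19)-reading and whose `Restricted` implies the based (1.29)-reading (`Prop7AxialReprPrint`, p568814: both Sect. A laws of the knit are
THEOREMS for these letters; `Prop7Orbit16Unsat.not_orbit16_print`, p574741: the LQB law `Orbit16` is refuted for them and is NOT used).  This file TYPES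
that presentation.  Nothing of Bałaban's analysis is asserted: a `def` of a presentation, its `rfl` unfoldings, and non-vacuity.

WHAT IS DEFINED (member `F`, heights `n ≤ K`, `k := K − n`, base point `x₀ := embIter k 0`; `U♯ := pull (unitsField (toUField U)) x₀`,
`u♯ := pullGauge (toUnits ∘ toUGauge u) x₀`, `X♯ := pull X x₀`; `L := (F.P K).L`, `η := T3SectALandauChart.eta F n K = L^{−k}`):
* `basePt F n K := embIter (K − n) 0` — the `k`-centre at which the `ℤᵈ` block corners `Lᵏz` ARE the torus `k`-centres (`Prop7AxialReprPrint.embIter_eq_transl`;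
  CARD-19200-V3-g8 §1(c): the corner ∕ centre seam);
* `IsAxialPrint F n K U₀ U := InAx L k (torusLam k) U₀♯ U♯` — **(18)₃ «U ∈ Ax_k(𝔅_k, U₀)» = [Balaban1985RegularSpaces] (1.19), the ITERATED axial gauge**
  (`B8Eq119TwistedAxial.InAx`; CARD §1(e) verbatim; NOT the complete comb gauge of `Prop7AxialGauge` — CARD §1(b): (81) pins `u` only through (76));
* `RestrictedPrint F n K U₀ u := Restr129 L k (torusLam k) U₀♯ u♯` — **«\overline{R₀u}ʲ = 1 on Λ_j» = (1.29) = [Balaban1985Averaging] (78)–(81)**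
  (`B8Eq119TwistedAxial.Restr129`; CARD §1(d)–(e) verbatim);
* `IsLandauPrint F n K U₀ X := IsLandau138 L k η univ (torusLam k) U₀♯ (η⁻¹X)♯` — **(21) «R(U₀)D^{η*}_{U₀}A = 0» = (1.38) in the multiplier form of
  record** (`B8Eq138LandauZd.IsLandau138`, `k` levels, Dirichlet domain `Ω₀ = T_η`; `A = η⁻¹X` since (19) has `U₁ = e^{iηA}`, `X = ηA`) — token for token
  the (1.38) conjunct of `B8Thm2SetupTorus.Concl2Setup` read at `x₀` (RULING g23-№3 (c1): ONE convention, every letter on the based pullback);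
* `AvgCondPrint F n K h V U₀ X` — **(20) «Q_j(U₀, ηA) = B on Λ_j» IN ITS DEFINING FORM [Balaban1985RegularSpaces] (1.28)–(1.30) p. 81**: the configuration
  `U₁U₀`, `U₁ = e^{iX}`, lies on the surface `Σ_k` — it is carried by a based-(1.29)-restricted gauge transformation `u` to an element `(U₁U₀)^u` of
  `Ax_k(𝔅_k, U₀) ∩ 𝔅_k(𝔅_k, V)` («Let us denote this set by Σ_k … Σ_k is not contained in 𝔅_k(𝔅_k, V) because the gauge transformations u do not satisfy
  the necessary conditions (1.14)», p. 81; (1.30) «The configurations U′ satisfy the equations Ũ′ʲ = V(Ū₀ʲ)⁻¹ on Λ_j, hence U₁ satisfies (Ũ₁^{u j})_b = … =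
  V_b(Ū₀ʲ)_b⁻¹»).  Print's `u`-FREE rewriting of (1.30) into «(1/i) log Ū₁ʲ = B», (1.31) ∕ (1.37) ∕ [7] (20), is «basically of an algebraic character and
  it follows from the construction» (p. 83) and is CERTIFIED on the `ℤᵈ` carriers (`B8Eq131Derivation`, r05); it is not re-derived at the T³ objects here
  (the B8 lane's (1.37) of record, `B8Thm2TorusAt.C137T`, is the BOUND `|B| < 2dLα₁` only).  `𝔅_k(𝔅_k, V)` = the descent fibre `T3ConstrainedMinimiser.fibre`
  of the family's averaging `ℰp`;
* `CritLPrint F n K h V U₀ U₁` — **«U₁ is a critical configuration of the functional A(U₁U₀) in the space defined by (19)–(21)» READ THROUGH THE CHART**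
  (Prop. 2 + p. 281 «The above mapping is one-to-one, hence using again the gauge invariance of the functional (5), we have reduced a proof of the existence
  and the uniqueness of critical configurations in the space (18), to a proof of the existence and the uniqueness in the space of configurations U₁U₀
  satisfying (19)–(21)»): `U₁U₀` is carried by a based-(1.29)-restricted `u` to a configuration of (18) that is critical in the carrier's READING R2
  (`T3Thm1CarrierNative.IsCritR2`, declared weaker than print there);
* **`sPrintAt F n K h T : Resid F n K := { T with IsAxial, Restricted, AvgCond, IsLandau, CritL := the five letters above }`** and
  **`sPrint L T : ResidFam L := fun i => sPrintAt … (T i)`** — the Sect. C–E letters (`In43 … SolAnalytic`: the operators `H`, `D`, `𝔊`, `H₁` of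
  [Balaban1985Variational] (43)–(115) at a CURVED background) are NOT pinned here: they have no body at the T³ objects in the tree (`T3SectALandauChart` §4)
  and stay the presentation parameter `T` (the P-V3-CDE lane's to instantiate).  `B11.Prop2Printed` reads none of them, so P-V3-A′ at `sPrint L T` is ONE
  statement for every `T`.

WHAT IS PROVED (sorry-free): the `Iff.rfl` unfoldings (`sPrint_isAxial_iff`, `…_restricted_iff`, `…_avgCond_iff`, `…_isLandau_iff`, `…_critL_iff`); the
knit's two binder-shape hypotheses AS THEOREMS for `sPrint` (`hSax_sPrint` = `Iff.rfl`, `hSre_sPrint` = `id`, the shapes of `prop7From14At_of_pillars_print`);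
non-vacuity (`restricted_sPrint_one`: `u = 1` is restricted w.r.t. every `U₀`; `isAxial_sPrint_self`: `U₀ ∈ Ax_k(𝔅_k, U₀)`; `critL_sPrint_one_of_isCritR2` ∕
`avgCond_sPrint_of_mem`: an axial R2-critical `U` of the fibre of `V` is, as the perturbation `U₁ = UU₀⁻¹` with `u = 1`, «critical in (19)–(21)» and on `Σ_k`);
`not_orbit16_sPrint` (the LQB law is refuted for `sPrint`, by `Prop7Orbit16Unsat.not_orbit16_print`); and **`prop7From14At_of_pillars_sPrint`**: the v8
composition `T3Thm1CarrierNative.Prop7From14At L B₃ ⇐ P-V3-A′(sPrint L T) ∧ P-V3-CDE(sPrint L T)` BY NAME (`prop7From14At_of_pillars_print` at `sPrint`).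

HONEST SCOPE.  A presentation and bookkeeping; no estimate.  The readings are the tree's declared ones: criticality = reading R2; (20) in the (1.30) form
(so `AvgCondPrint` and `CritLPrint` overlap in «∃ restricted u with (U₁U₀)^u axial»: print's (20) is the equation of the surface on which (19)–(21)'s
criticality is taken); (1.38) in multiplier form; the `ℤᵈ` letters pin corner-anchored blocks, which at the base point `x₀` are the T³ `k`-centres
(CARD §1(c); the residual half-block offset against the `blockOf` partition inside the gauge condition is harmless for the knit's laws, and [6] Thm 2 for
the based letters is `B8Thm2SetupTorus.Thm2SetupSUAt` at `x₀`-translated data by `Prop7BasedTranslate` — the P-V3-A′ pen's dictionary, RULING g23-№3 (c2)).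
Count-neutral toward stmt-QuantumFields-19200 (`--supports`); not a proof of any stub; nothing continuum ∕ OS ∕ mass-gap ∕ Clay.

References: T. Bałaban, CMP **102** (1985) 277–309 [Balaban1985Variational] ((14)–(18) p.280, (19)–(21) and Prop. 2 p.281, Prop. 7 p.299); CMP **99** (1985)
75–102 [Balaban1985RegularSpaces] ((1.14) p.78, (1.19) p.79, (1.28)–(1.30) p.81, (1.31) and (1.38) p.82, Thm 2 p.83); CMP **98** (1985) 17–51
[Balaban1985Averaging] ((8) p.19, (78)–(81) p.30, (87) p.31); [Balaban1987RG1] (0.1) p.251 (centres of cubes).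
-/

noncomputable section

namespace Summit.QuantumFields.YangMills.Theorems.Prop7SPrint

open scoped Matrix.Norms.L2Operator
open NormedSpace
open Literature.MathematicalPhysics.QuantumFieldTheory.Balaban1983to89
open Literature.MathematicalPhysics.QuantumFieldTheory.Balaban1983to89.T3ContinuumYM3Torus
open Literature.MathematicalPhysics.QuantumFieldTheory.Balaban1983to89.T3UnitLawDensityEML (ℰp)
open Literature.MathematicalPhysics.QuantumFieldTheory.Balaban1983to89.T3PrintedRegularMinimiser (regFibrePr)
open Literature.MathematicalPhysics.QuantumFieldTheory.Balaban1983to89.T3PrintedRegularOrbits (descTransf)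
open Literature.MathematicalPhysics.QuantumFieldTheory.Balaban1983to89.T3ConstrainedMinimiser (fibre)
open B7Prop1Explicit renaming Site → LSite
open B8Eq119TwistedAxial (InAx Restr129)
open B8Eq138LandauZd (IsLandau138)
open B8Thm4TorusAt (torusLam)
open B15DeterminingSets (embIter)
open B10Eq27TorusAxialLog (pull unitsField toUField)
open B8Thm2SetupTorus (pullGauge toUGauge)
open B11 (LGData Prop2Printed Prop5Printed Prop6Printed)
open B11Prop7Assembly (ExistenceLeavesCap)
open T3Thm1Carrier
open T3Thm1CarrierNative (IsCritR2 Prop7From14At)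
open T3SectALandauChart

/-! ## §1 The five Sect. A–B letters of print, based at the `k`-centre -/

section Letters

variable (F : T3Family) (n K : ℕ)

/-- **THE BASE POINT `x₀ = embIter k 0`** (`k = K − n`): the `k`-centre of the torus at which the `ℤᵈ` lane's corner-anchored blocks `Lᵏz + [0, Lᵏ)ᵈ` are
anchored AT the T³ carrier's `k`-centres (`embIter k y = x₀ + Lᵏ·ỹ`, `Prop7AxialReprPrint.embIter_eq_transl`), so that the pinning group (1.14) of the `ℤᵈ`
letters IS the carrier's group (4). [cite: Balaban1987RG1, (0.1) p.251; Balaban1985RegularSpaces, (1.14) p.78] -/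
def basePt : Site (F.P K) 0 := embIter (K - n) (0 : Site (F.P K) (K - n))

/-- **(18)₃ «U ∈ Ax_k(𝔅_k, U₀)» — THE ITERATED AXIAL GAUGE (1.19) OF [6] RELATIVE TO THE BACKGROUND `U₀`**, read as `B8Eq119TwistedAxial.InAx L k (torusLam k)`
on the periodic pullbacks of `U₀`, `U` based at the `k`-centre `x₀` (CARD-19200-V3-g8 §1(e), verbatim; `𝔅_k = T^{(k)}`).
[cite: Balaban1985Variational, (18) p.280; Balaban1985RegularSpaces, (1.19) p.79] -/
def IsAxialPrint (U₀ U : GaugeField (F.P K) 0 (Matrix.specialUnitaryGroup (Fin 2) ℂ)) : Prop :=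
  InAx (F.P K).L (K - n) (torusLam (K - n)) (pull (unitsField (toUField U₀)) (basePt F n K)) (pull (unitsField (toUField U)) (basePt F n K))

/-- **«\overline{R₀u}ʲ = 1 on Λ_j, j = 0, …, k» — THE RESTRICTION (1.29) OF [6] ON THE CHART'S GAUGE TRANSFORMATIONS** ([Balaban1985Averaging] (78)–(81): averages
of `u`, NOT the group (4)), read as `B8Eq119TwistedAxial.Restr129 L k (torusLam k)` on the pullbacks based at `x₀` (CARD-19200-V3-g8 §1(d)–(e), verbatim).
[cite: Balaban1985Variational, Prop. 2 p.281; Balaban1985RegularSpaces, (1.29) p.81; Balaban1985Averaging, (78)–(81) p.30] -/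
def RestrictedPrint (U₀ : GaugeField (F.P K) 0 (Matrix.specialUnitaryGroup (Fin 2) ℂ))
    (u : GaugeTransf (F.P K) 0 (Matrix.specialUnitaryGroup (Fin 2) ℂ)) : Prop :=
  Restr129 (F.P K).L (K - n) (torusLam (K - n)) (pull (unitsField (toUField U₀)) (basePt F n K))
    (pullGauge (fun x => Unitary.toUnits (toUGauge (F.P K) 2 u x)) (basePt F n K))

/-- **(21) «R(U₀)D^{η*}_{U₀}A = 0» — THE PROJECTED LANDAU GAUGE CONDITION (1.38) OF [6] IN THE MULTIPLIER FORM OF RECORD** `B8Eq138LandauZd.IsLandau138 L k η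
univ (torusLam k)` (`k` averaging levels, Dirichlet domain `Ω₀ = T_η`), on the based pullbacks of the background and of `A = η⁻¹X` (`X = ηA` is the exponent of
(19), `U₁ = e^{iηA} = e^{iX}`; `η = L^{−k}`) — the (1.38) conjunct of `B8Thm2SetupTorus.Concl2Setup` read at `x₀`.
[cite: Balaban1985Variational, (21) p.281; Balaban1985RegularSpaces, (1.38) p.82] -/
def IsLandauPrint (U₀ : GaugeField (F.P K) 0 (Matrix.specialUnitaryGroup (Fin 2) ℂ)) (X : PBond (F.P K) 0 → Matrix (Fin 2) (Fin 2) ℂ) : Prop :=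
  IsLandau138 (F.P K).L (K - n) (eta F n K) (Set.univ : Set (LSite (F.P K).d)) (torusLam (K - n))
    (pull (unitsField (toUField U₀)) (basePt F n K)) (pull (fun b => (eta F n K)⁻¹ • X b) (basePt F n K))

variable (h : n ≤ K)

/-- **(20) «Q_j(U₀, ηA) = B on Λ_j» IN ITS DEFINING FORM (1.28)–(1.30) OF [6]: `U₁U₀` LIES ON THE SURFACE `Σ_k`** — for the perturbation `U₁ = e^{iX}` (bondwise;
the exponential relation of (19)), there is a gauge transformation `u` with the based restriction (1.29) carrying `U₁U₀` to `(U₁U₀)^u ∈ Ax_k(𝔅_k, U₀) ∩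
𝔅_k(𝔅_k, V)` (based (1.19); descent fibre of `V` for the family's averaging).  [6] p. 81: «We have to describe more exactly the set of configurations obtained
by transformation of 𝔅_k(𝔅_k, V) ∩ Ax_k(𝔅_k, U₀) using the gauge transformations u … restricted additionally by the conditions (1.29) … Let us denote this set
by Σ_k»; (1.30) «The configurations U′ satisfy the equations Ũ′ʲ = V(Ū₀ʲ)⁻¹ on Λ_j, hence U₁ satisfies (Ũ₁^{u j})_b = … = V_b(Ū₀ʲ)_b⁻¹».  Print's `u`-free
form (1.31) ∕ (1.37) ∕ [7] (20) of the same condition is certified on `ℤᵈ` (`B8Eq131Derivation`) and not re-derived here.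
[cite: Balaban1985Variational, (20) p.281; Balaban1985RegularSpaces, (1.28)–(1.30) p.81, (1.31) and (1.37) p.82] -/
def AvgCondPrint (V : GaugeField (F.P n) 0 (Matrix.specialUnitaryGroup (Fin 2) ℂ)) (U₀ : GaugeField (F.P K) 0 (Matrix.specialUnitaryGroup (Fin 2) ℂ))
    (X : PBond (F.P K) 0 → Matrix (Fin 2) (Fin 2) ℂ) : Prop :=
  ∀ U₁ : GaugeField (F.P K) 0 (Matrix.specialUnitaryGroup (Fin 2) ℂ),
    (∀ b : PBond (F.P K) 0, ((U₁ b : Matrix.specialUnitaryGroup (Fin 2) ℂ) : Matrix (Fin 2) (Fin 2) ℂ) = exp (Complex.I • X b)) →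
      ∃ u : GaugeTransf (F.P K) 0 (Matrix.specialUnitaryGroup (Fin 2) ℂ),
        RestrictedPrint F n K U₀ u ∧ IsAxialPrint F n K U₀ (GaugeField.gaugeAct u (emb15 U₀ U₁)) ∧
          GaugeField.gaugeAct u (emb15 U₀ U₁) ∈ fibre F ℰp n K h V

/-- **«U₁ IS A CRITICAL CONFIGURATION OF THE FUNCTIONAL A(U₁U₀) IN THE SPACE DEFINED BY (19)–(21)», READ THROUGH THE CHART OF PROP. 2**: `U₁U₀` is carried
by a based-(1.29)-restricted gauge transformation `u` to a configuration `(U₁U₀)^u` of the space (18) (based (1.19)) which is a critical configuration of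
(5) in the carrier's READING R2 (`T3Thm1CarrierNative.IsCritR2`: a minimiser over print's regular fibre (6)(e) of `V` for some `e > 0`).  p. 281: «The above
mapping is one-to-one, hence using again the gauge invariance of the functional (5), we have reduced a proof of the existence and the uniqueness of
critical configurations in the space (18), to a proof of the existence and the uniqueness in the space of configurations U₁U₀ satisfying (19)–(21)».
[cite: Balaban1985Variational, Prop. 2 p.281, (18) p.280, (4)–(6) p.278] -/
def CritLPrint (V : GaugeField (F.P n) 0 (Matrix.specialUnitaryGroup (Fin 2) ℂ))
    (U₀ U₁ : GaugeField (F.P K) 0 (Matrix.specialUnitaryGroup (Fin 2) ℂ)) : Prop :=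
  ∃ u : GaugeTransf (F.P K) 0 (Matrix.specialUnitaryGroup (Fin 2) ℂ),
    RestrictedPrint F n K U₀ u ∧ IsAxialPrint F n K U₀ (GaugeField.gaugeAct u (emb15 U₀ U₁)) ∧
      IsCritR2 F n K h V (GaugeField.gaugeAct u (emb15 U₀ U₁))

/-! ## §2 The presentation `S_print` -/

/-- **PRINT'S PRESENTATION OF SECT. A–B AT ONE MEMBER** (`F`, `n ≤ K`): the residual layer `T3SectALandauChart.Resid` with its five Sect. A–B letters PINNED to
print's based letters (`IsAxialPrint`, `RestrictedPrint`, `AvgCondPrint`, `IsLandauPrint`, `CritLPrint`) and the Sect. C–E letters (`In43 … SolAnalytic`, the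
operators of (43)–(115) at a curved background — no body at the T³ objects in the tree) taken from the parameter `T` (OWNER RULING g23-№3 (α);
CARD-19200-V3-g8 §1(e)). [cite: Balaban1985Variational, (14)–(21) pp.280–281, Prop. 2 p.281; Balaban1985RegularSpaces, (1.19) p.79, (1.29) p.81, (1.38) p.82] -/
def sPrintAt (T : Resid F n K) : Resid F n K :=
  { T with
    IsAxial := IsAxialPrint F n K
    Restricted := RestrictedPrint F n K
    AvgCond := AvgCondPrint F n K h
    IsLandau := IsLandauPrint F n K
    CritL := CritLPrint F n K h }

end Letters

/-- **`S_print` OVER THE FAMILY OF CARRIERS WITH BLOCK SIZE `L`** (`T3Thm1Carrier.Idx L`): at every member the presentation `sPrintAt` with the Sect. C–E tail of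
`T`.  With it the v8 pillars read `B11.Prop2Printed B₁ B₃ L³ c₁ (famLG3 L (sPrint L T))` (P-V3-A′) and `Prop5Printed ∧ Prop6Printed … (famLG3 L (sPrint L T))` +
leaves (P-V3-CDE) (CARD-19200-V3-g8 §3). [cite: Balaban1985Variational, Thm 1 p.279 («The constants … depend on d and L only»), Prop. 2 p.281] -/
def sPrint (L : ℕ) (T : ResidFam L) : ResidFam L := fun i => sPrintAt i.1.1 i.1.2.1 i.1.2.2 i.2.2.le (T i)

/-! ## §3 Unfoldings (definitional) -/

section Unfold

variable {L : ℕ} (T : ResidFam L) (i : Idx L)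

/-- `IsAxial` of `S_print` IS the based (1.19)-reading (definitional; the knit's hypothesis `hSax` for `S_print` is `Iff.rfl`).
[cite: Balaban1985RegularSpaces, (1.19) p.79] -/
theorem sPrint_isAxial_iff (U₀ U : GaugeField (i.1.1.P i.1.2.2) 0 (Matrix.specialUnitaryGroup (Fin 2) ℂ)) :
    (sPrint L T i).IsAxial U₀ U ↔
      InAx (i.1.1.P i.1.2.2).L (i.1.2.2 - i.1.2.1) (torusLam (i.1.2.2 - i.1.2.1))
        (pull (unitsField (toUField U₀)) (embIter (i.1.2.2 - i.1.2.1) (0 : Site (i.1.1.P i.1.2.2) (i.1.2.2 - i.1.2.1))))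
        (pull (unitsField (toUField U)) (embIter (i.1.2.2 - i.1.2.1) (0 : Site (i.1.1.P i.1.2.2) (i.1.2.2 - i.1.2.1)))) :=
  Iff.rfl

/-- `Restricted` of `S_print` IS the based (1.29)-reading (definitional). [cite: Balaban1985RegularSpaces, (1.29) p.81] -/
theorem sPrint_restricted_iff (U₀ : GaugeField (i.1.1.P i.1.2.2) 0 (Matrix.specialUnitaryGroup (Fin 2) ℂ))
    (u : GaugeTransf (i.1.1.P i.1.2.2) 0 (Matrix.specialUnitaryGroup (Fin 2) ℂ)) :
    (sPrint L T i).Restricted U₀ u ↔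
      Restr129 (i.1.1.P i.1.2.2).L (i.1.2.2 - i.1.2.1) (torusLam (i.1.2.2 - i.1.2.1))
        (pull (unitsField (toUField U₀)) (embIter (i.1.2.2 - i.1.2.1) (0 : Site (i.1.1.P i.1.2.2) (i.1.2.2 - i.1.2.1))))
        (pullGauge (fun x => Unitary.toUnits (toUGauge (i.1.1.P i.1.2.2) 2 u x)) (embIter (i.1.2.2 - i.1.2.1) (0 : Site (i.1.1.P i.1.2.2) (i.1.2.2 - i.1.2.1)))) :=
  Iff.rfl

/-- `AvgCond` of `S_print` IS `AvgCondPrint` (definitional). [cite: Balaban1985Variational, (20) p.281] -/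
theorem sPrint_avgCond_iff (V : GaugeField (i.1.1.P i.1.2.1) 0 (Matrix.specialUnitaryGroup (Fin 2) ℂ))
    (U₀ : GaugeField (i.1.1.P i.1.2.2) 0 (Matrix.specialUnitaryGroup (Fin 2) ℂ)) (X : PBond (i.1.1.P i.1.2.2) 0 → Matrix (Fin 2) (Fin 2) ℂ) :
    (sPrint L T i).AvgCond V U₀ X ↔ AvgCondPrint i.1.1 i.1.2.1 i.1.2.2 i.2.2.le V U₀ X :=
  Iff.rfl

/-- `IsLandau` of `S_print` IS `IsLandauPrint` (definitional). [cite: Balaban1985Variational, (21) p.281] -/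
theorem sPrint_isLandau_iff (U₀ : GaugeField (i.1.1.P i.1.2.2) 0 (Matrix.specialUnitaryGroup (Fin 2) ℂ))
    (X : PBond (i.1.1.P i.1.2.2) 0 → Matrix (Fin 2) (Fin 2) ℂ) :
    (sPrint L T i).IsLandau U₀ X ↔ IsLandauPrint i.1.1 i.1.2.1 i.1.2.2 U₀ X :=
  Iff.rfl

/-- `CritL` of `S_print` IS `CritLPrint` (definitional). [cite: Balaban1985Variational, Prop. 2 p.281] -/
theorem sPrint_critL_iff (V : GaugeField (i.1.1.P i.1.2.1) 0 (Matrix.specialUnitaryGroup (Fin 2) ℂ))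
    (U₀ U₁ : GaugeField (i.1.1.P i.1.2.2) 0 (Matrix.specialUnitaryGroup (Fin 2) ℂ)) :
    (sPrint L T i).CritL V U₀ U₁ ↔ CritLPrint i.1.1 i.1.2.1 i.1.2.2 i.2.2.le V U₀ U₁ :=
  Iff.rfl

/-- The Sect. C–E tail of `S_print` is the parameter's (here `Sol111`, the one Prop. 5, Prop. 6 and the leaf `crit112` read; definitional).
[cite: Balaban1985Variational, (111) p.294] -/
theorem sPrint_sol111 : (sPrint L T i).Sol111 = (T i).Sol111 := rfl

end Unfold

/-! ## §4 The knit's binder-shape hypotheses for `S_print`, as theorems -/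

section Knit

variable {L : ℕ} (T : ResidFam L)

/-- **`hSax` OF `Prop7PillarsPrint.prop7From14At_of_pillars_print` FOR `S_print`**: `IsAxial ↔` the based (1.19)-reading, at every member (`Iff.rfl`).
[cite: Balaban1985RegularSpaces, (1.19) p.79; Balaban1985Variational, (18) p.280] -/
theorem hSax_sPrint : ∀ (i : Idx L) (U₀ U : GaugeField (i.1.1.P i.1.2.2) 0 (Matrix.specialUnitaryGroup (Fin 2) ℂ)),
    (sPrint L T i).IsAxial U₀ U ↔
      InAx (i.1.1.P i.1.2.2).L (i.1.2.2 - i.1.2.1) (torusLam (i.1.2.2 - i.1.2.1))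
        (pull (unitsField (toUField U₀)) (embIter (i.1.2.2 - i.1.2.1) (0 : Site (i.1.1.P i.1.2.2) (i.1.2.2 - i.1.2.1))))
        (pull (unitsField (toUField U)) (embIter (i.1.2.2 - i.1.2.1) (0 : Site (i.1.1.P i.1.2.2) (i.1.2.2 - i.1.2.1)))) :=
  fun _ _ _ => Iff.rfl

/-- **`hSre` OF `Prop7PillarsPrint.prop7From14At_of_pillars_print` FOR `S_print`**: `Restricted →` the based (1.29)-reading, at every member (`id`).
[cite: Balaban1985RegularSpaces, (1.29) p.81; Balaban1985Variational, Prop. 2 p.281] -/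
theorem hSre_sPrint : ∀ (i : Idx L) (U₀ : GaugeField (i.1.1.P i.1.2.2) 0 (Matrix.specialUnitaryGroup (Fin 2) ℂ))
    (u : GaugeTransf (i.1.1.P i.1.2.2) 0 (Matrix.specialUnitaryGroup (Fin 2) ℂ)), (sPrint L T i).Restricted U₀ u →
      Restr129 (i.1.1.P i.1.2.2).L (i.1.2.2 - i.1.2.1) (torusLam (i.1.2.2 - i.1.2.1))
        (pull (unitsField (toUField U₀)) (embIter (i.1.2.2 - i.1.2.1) (0 : Site (i.1.1.P i.1.2.2) (i.1.2.2 - i.1.2.1))))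
        (pullGauge (fun x => Unitary.toUnits (toUGauge (i.1.1.P i.1.2.2) 2 u x)) (embIter (i.1.2.2 - i.1.2.1) (0 : Site (i.1.1.P i.1.2.2) (i.1.2.2 - i.1.2.1)))) :=
  fun _ _ _ hu => hu

/-- **THE v8 COMPOSITION AT `S_print`, BY NAME** — `T3Thm1CarrierNative.Prop7From14At L B₃` (= the text of the registered stub `stub_prop7From14`, leaf V3) FROM
P-V3-A′ `∃ B₁ c₁ > 0, Prop2Printed B₁ B₃ L³ c₁ (famLG3 L (sPrint L T))` AND P-V3-CDE `∃ B₀ B₁ O₁ O₂ e₅, Prop5Printed ∧ Prop6Printed … (famLG3 L (sPrint L T)) ∧ ∀ i,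
ExistenceLeavesCap (bridgeFam3 L (sPrint L T) i) …`, for `L > 1` and every `B₃ ≥ 1` (the registered stub has `4 < B₃`): `Prop7PillarsPrint.prop7From14At_of_pillars_print`
with `hSax_sPrint`, `hSre_sPrint` — no presented law (`Orbit16` is refuted for `S_print`, `not_orbit16_sPrint`; the axial-representative law is
`Prop7AxialReprPrint.axialRepr_print_based`, inside the knit). [cite: Balaban1985Variational, Prop. 7 p.299, Prop. 2 p.281, Props 5–6 pp.294–295] -/
theorem prop7From14At_of_pillars_sPrint (hL : 1 < L) {B₃ : ℝ} (hB₃ : 1 ≤ B₃)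
    (hA : ∃ B₁ c₁ : ℝ, 0 < B₁ ∧ 0 < c₁ ∧ Prop2Printed B₁ B₃ ((L : ℝ) ^ 3) c₁ (famLG3 L (sPrint L T)))
    (hCDE : ∃ B₀ B₁ O₁ O₂ e₅ : ℝ, 0 < B₀ ∧ 0 < B₁ ∧ 1 ≤ O₁ ∧ 1 ≤ O₂ ∧ 0 < e₅ ∧
      Prop5Printed B₁ B₃ ((L : ℝ) ^ 3) (famLG3 L (sPrint L T)) ∧ Prop6Printed B₀ B₃ ((L : ℝ) ^ 3) (famLG3 L (sPrint L T)) ∧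
      ∀ i : Idx L, ExistenceLeavesCap (bridgeFam3 L (sPrint L T) i) B₀ B₃ ((L : ℝ) ^ 3) O₁ O₂ e₅) :
    Prop7From14At L B₃ :=
  Summit.QuantumFields.YangMills.Theorems.Prop7PillarsPrint.prop7From14At_of_pillars_print hL (sPrint L T) hB₃
    (hSax_sPrint T) (hSre_sPrint T) hA hCDE

end Knit

/-! ## §5 Non-vacuity of the pinned letters, and the refuted LQB law -/

section Sanity

variable (F : T3Family) {n K : ℕ} (h : n ≤ K) (T : Resid F n K)

/-- **`u = 1` IS RESTRICTED w.r.t. EVERY BACKGROUND** (`Prop7PrintLettersSanity.restr129_based_one`: all the averages (78)–(80) of the trivial gauge transformation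
are `1`). [cite: Balaban1985RegularSpaces, (1.29) p.81] -/
theorem restricted_sPrint_one (U₀ : GaugeField (F.P K) 0 (Matrix.specialUnitaryGroup (Fin 2) ℂ)) :
    (sPrintAt F n K h T).Restricted U₀ (fun _ => 1) :=
  Summit.QuantumFields.YangMills.Theorems.Prop7PrintLettersSanity.restr129_based_one (K - n) _ U₀ _

/-- **`U₀ ∈ Ax_k(𝔅_k, U₀)`** (`Prop7PrintLettersSanity.inAx_based_self`; [6] p. 78 «the surfaces pass through the element U₀»).
[cite: Balaban1985RegularSpaces, p.78, (1.19) p.79] -/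
theorem isAxial_sPrint_self (U₀ : GaugeField (F.P K) 0 (Matrix.specialUnitaryGroup (Fin 2) ℂ)) :
    (sPrintAt F n K h T).IsAxial U₀ U₀ :=
  Summit.QuantumFields.YangMills.Theorems.Prop7PrintLettersSanity.inAx_based_self (K - n) _ U₀ _

variable {F h T}

/-- The trivial gauge transformation acts trivially (local helper). [folklore] -/
private theorem gaugeAct_one (U : GaugeField (F.P K) 0 (Matrix.specialUnitaryGroup (Fin 2) ℂ)) :
    GaugeField.gaugeAct (fun _ => (1 : Matrix.specialUnitaryGroup (Fin 2) ℂ)) U = U := by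
  funext b; simp [GaugeField.gaugeAct]

/-- **`CritL` OF `S_print` IS INHABITED BY THE CHART PREIMAGES THEMSELVES**: an axial configuration `U` that is critical in reading R2 over the fibre of `V` is,
as the perturbation `U₁ := UU₀⁻¹` (so `U₁U₀ = U`, (15)) with `u = 1`, «critical in the space (19)–(21)» relative to `U₀`.
[cite: Balaban1985Variational, Prop. 2 p.281, (15) p.280] -/
theorem critL_sPrint_of_isCritR2 {V : GaugeField (F.P n) 0 (Matrix.specialUnitaryGroup (Fin 2) ℂ)}
    {U₀ U : GaugeField (F.P K) 0 (Matrix.specialUnitaryGroup (Fin 2) ℂ)} (hax : IsAxialPrint F n K U₀ U) (hc : IsCritR2 F n K h V U) :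
    (sPrintAt F n K h T).CritL V U₀ (pert U₀ U) := by
  refine ⟨fun _ => 1, restricted_sPrint_one F h T U₀, ?_, ?_⟩
  · rw [emb15_pert, gaugeAct_one]; exact hax
  · rw [emb15_pert, gaugeAct_one]; exact hc

/-- **`AvgCond` OF `S_print` IS INHABITED THE SAME WAY**: for an axial `U` in the descent fibre of `V` and ANY exponent `X` with `UU₀⁻¹ = e^{iX}` bondwise, (20)
holds at `(V, U₀, X)` with `u = 1`. [cite: Balaban1985Variational, (20) p.281; Balaban1985RegularSpaces, (1.28)–(1.30) p.81] -/
theorem avgCond_sPrint_of_mem {V : GaugeField (F.P n) 0 (Matrix.specialUnitaryGroup (Fin 2) ℂ)}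
    {U₀ U : GaugeField (F.P K) 0 (Matrix.specialUnitaryGroup (Fin 2) ℂ)} (hax : IsAxialPrint F n K U₀ U) (hU : U ∈ fibre F ℰp n K h V)
    {X : PBond (F.P K) 0 → Matrix (Fin 2) (Fin 2) ℂ}
    (hX : ∀ b : PBond (F.P K) 0, ((pert U₀ U b : Matrix.specialUnitaryGroup (Fin 2) ℂ) : Matrix (Fin 2) (Fin 2) ℂ) = exp (Complex.I • X b)) :
    (sPrintAt F n K h T).AvgCond V U₀ X := by
  intro U₁ hU₁
  have hU₁eq : U₁ = pert U₀ U := by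
    funext b
    exact Subtype.ext ((hU₁ b).trans (hX b).symm)
  subst hU₁eq
  refine ⟨fun _ => 1, restricted_sPrint_one F h T U₀, ?_, ?_⟩
  · rw [emb15_pert, gaugeAct_one]; exact hax
  · rw [emb15_pert, gaugeAct_one]; exact hU

variable (F h T)

/-- **THE LQB LAW `Orbit16` IS REFUTED FOR `S_print`** (`n < K`): `Prop7Orbit16Unsat.not_orbit16_print` applies, `Restricted` of `S_print` being the based
(1.29)-reading — so the v8 pen carries no `Orbit16` law (CARD-19200-V3-g8 §1(a); RULING g23-№3). [cite: Balaban1985Variational, p.281 («The above mapping is one-to-one»); Balaban1985RegularSpaces, (1.29) p.81] -/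
theorem not_orbit16_sPrint (hnK : n < K) : ¬ Orbit16 F n K h (sPrintAt F n K h T) :=
  Summit.QuantumFields.YangMills.Theorems.Prop7Orbit16Unsat.not_orbit16_print F hnK (sPrintAt F n K h T) (fun _ _ hu => hu)

end Sanity

end Summit.QuantumFields.YangMills.Theorems.Prop7SPrint

end
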